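import Literature.NumberTheory.EllipticCurves.Kim2026.ShaLengthRankZeroUpperBound
import Literature.NumberTheory.EllipticCurves.Rank1Residual.PrintShape
import Literature.NumberTheory.EllipticCurves.Rank1Residual.X10Proofs
import Literature.NumberTheory.EllipticCurves.Rank1Residual.Typed.X4
import Literature.NumberTheory.EllipticCurves.Rank1Residual.Typed.KolyvaginCertificate
import Summits.BirchSwinnertonDyer.Rank1Residual.Additive.SharpenedStatements
import HarnessLib

/-!
# Toward X4♯ in analytic rank `0` at `p ≥ 5`: the upper-bound inequality `ord_p #Ш ≤ ord_p #Ш_an + ord_p Tam` from Kim 2026 Thm. 1.8 at an ADDITIVE prime (cell `b2b-bsdres`, seat additive-p4)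

HONEST FRAMING (cell `b2b-bsdres`, run/shared/lean/b2b/bsd-rank1-residual/, verbatim in every
file): the goal of the cell is to DELETE the COMBINATION-SHAPED residual classes of the
Birch–Swinnerton-Dyer formula for ALL analytic-rank `≤ 1` elliptic curves over `ℚ` — "full BSD
formula for every rank `≤ 1` curve in class `C`" assembled STRICTLY from published theorems — so
that the rank-`≤ 1` remainder becomes exactly the CONSTRUCTION-SHAPED classes, which are TYPED
(missing-input `Prop`s), NOT attempted. This is not "finishing BSD". The additive sub-cell
(seats additive-p1…p4) is a RESEARCH ROUTE on the construction-shaped classes X3/X4; no claim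
beyond the stated classes.

**What this file proves** (theorems only; no definition, no new named fact; every arithmetic input is
an explicit PUBLISHED named-fact hypothesis). Class X4 = `p ≠ 2 ∧ Addv W p ∧ Irr W p`
(`Rank1Residual/Predicates.lean`). The sharpened conjecture X4♯(unit-free) (SHARPENED-CONJECTURES.md
v3.2 §4; Lean statement `Summit.BirchSwinnertonDyer.Rank1Residual.Additive.X4SharpUnitFree`, file
`Additive/SharpenedStatements.lean`) predicts `ord_p #Ш(E) = ord_p #Ш_an(E)` for every X4 pair of
analytic rank `0` with `ρ̄_{E,p}` surjective. Its "≤" HALF is a theorem at `p ≥ 5` when the Manin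
constant is prime to `p`:
* `padicValNat_shaOrder_le_of_kim_rankZero` (class-agnostic, ANY reduction at `p`): from the named
  fact `Kim2026.rankZero_padicValNat_sha_le_of_maninConstant` (C.-H. Kim, Amer. J. Math. 148 (2026)
  Thm. 1.8 (6) = arXiv Thm. 1.9 (6), read in rank `0`: `length Ш[p^∞] = ∂^{(0)}(δ̃) − ∂^{(∞)}(δ̃) ≤
  ∂^{(0)}(δ̃) = ord_p(L(E,1)/Ω⁺_E)`), Gross–Zagier–Kolyvagin (`hGZK`: rank `0`, `Ш` finite) and
  modularity (`hmod`: `r_an = 0 ⇔ L(E,1) ≠ 0`): `#Ш_an = q ∈ ℚ` with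
  `ord_p #Ш ≤ ord_p q + ord_p ∏ c_ℓ − 2 ord_p #E(ℚ)_tors`;
* `X4RankZero.padicValNat_shaOrder_le` (the class shape: `r_an = 0`, `ClassX4 W p`, `5 ≤ p`,
  `Surj W p`, a datum `D` with `p ∤ c_D`): `ord_p #Ш ≤ ord_p #Ш_an + ord_p ∏ c_ℓ` (the torsion term
  vanishes under irr(p), `padicValNat_torsionOrder_eq_zero_of_irreducible`, Mazur 1977);
* `X4RankZero.missingUpperBoundAt` (`p ∤ ∏ c_ℓ`): the typed UPPER half `MissingUpperBoundAt W p` of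
  `Typed/Basic.lean` HOLDS — so at these pairs the typed missing input of X4 shrinks to the LOWER
  half `MissingLowerBoundAt` (the "main-conjecture" direction): `X4RankZero.missingPPartAt_iff_lower`,
  `X4RankZero.bsdp_of_missingLowerBoundAt`;
* `X4RankZero.bsdp_of_shaAn_unit` (`p ∤ ∏ c_ℓ · #Ш_an`): Miller's `BSD(E,p)` — the census row T-KIM0
  of the cell (RESIDUAL-CASES §a.1 C15 / lever L5; 2392 ‖ 660 X4 pairs with `N < 2·10⁴ ‖ 10⁴`) WITH
  NO Kurihara-number certificate: the inequality alone forces `Ш(E)[p^∞] = 0 = ord_p #Ш_an`.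
What is NOT here: the equality (Kim's Conjecture 1.10 `∂^{(∞)}(δ̃) = ∑ ord_p c_ℓ`, open — it IS
X4♯(unit-free) at these pairs); `p = 3` (X4♯(3): Kim's `p ≥ 5` binds; nothing in print);
non-surjective images; analytic rank `1` (X4♯(r = 1): per pair via the tree fact
`Kim2022_rankOne_card_sha_eq_one_of_kuriharaNumber_ne_zero_of_maninConstant`, class-wide open). The
Manin hypothesis `p ∤ c_D` is a per-curve PUBLISHED input where available (Agashe–Ribet–Stein 2006:
`c = 1` for every optimal curve of conductor `< 60000` checked by Cremona; `c_D` of a non-optimal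
curve divides `c_{opt} ·` (isogeny degree), prime to `p` under irr(p)) — discharged by the
additive-p1 seat's Manin-datum work, not here.

References: Kim 2026 [Kim2022StructureSelmer] Thm. 1.9 (6), Conj. 1.10; Miller 2011 Def. 1.1
[Miller2011LMS]; Mazur 1977 III.5 [Mazur1977]; SHARPENED-CONJECTURES.md v3.2 §4; RESIDUAL-CASES §a.1 C15.
-/

noncomputable section

open scoped Classical

open WeierstrassCurve Literature.NumberTheory.EllipticCurves
  Literature.NumberTheory.EllipticCurves.ModularForms
  Literature.NumberTheory.EllipticCurves.Rank1Residual
  Literature.NumberTheory.EllipticCurves.Rank1Residual.Typed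

namespace Summit.BirchSwinnertonDyer.Rank1Residual.Additive

variable (W : WeierstrassCurve ℚ) [W.IsElliptic] [W.IsGloballyMinimal] (p : ℕ) [Fact p.Prime]

/-! ### Class-agnostic: the rank-`0` upper bound with the torsion term -/

/-- **Upper bound on `ord_p #Ш` in analytic rank `0` at `p ≥ 5` with `ρ̄_{E,p}` onto and a Manin
constant prime to `p`, ANY reduction type** (Kim 2026 Thm. 1.8 (6), named fact `hKim`;
Gross–Zagier–Kolyvagin `hGZK`; modularity `hmod`). With `#Ш_an = L(E,1)·#E(ℚ)_tors²/(Ω·∏ c_ℓ)`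
(rank `0`: `Reg = 1`, `L^{(0)}(E,1)/0! = L(E,1)`), Kim's `ord_p #Ш(p) ≤ ord_p(L(E,1)/Ω)` reads:
`#Ш_an = q ∈ ℚ` and `ord_p #Ш ≤ ord_p q + ord_p ∏ c_ℓ − 2 ord_p #E(ℚ)_tors`.
[cite: Kim2022StructureSelmer, Thm. 1.9 (6) (PDF p. 8)] [cite: Miller2011LMS, Def. 1.1] -/
theorem padicValNat_shaOrder_le_of_kim_rankZero (hKim : Kim2026.rankZero_padicValNat_sha_le_of_maninConstant)
    (hGZK : rank_eq_analyticRank_of_analyticRank_le_one) (hmod : hasEntireLFunction_rat)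
    (hp : 5 ≤ p) (hr : W.analyticRank = 0) (hsurj : W.HasSurjectiveModNGaloisRep p)
    {N : ℕ} [NeZero N] (D : ModularParametrizationData W N) (hc : ¬ (p : ℤ) ∣ D.maninConstant) :
    ∃ q : ℚ, shaAn W = (q : ℂ) ∧
      (padicValNat p W.shaOrder : ℤ) ≤
        padicValRat p q + padicValNat p W.tamagawaProduct - 2 * padicValNat p W.torsionOrder := by
  have hL : W.entireLFunction 1 ≠ 0 := (W.analyticRank_eq_zero_iff_holds (hmod W)).mp hr
  obtain ⟨hmw, hfin⟩ := hGZK W (by rw [hr]; exact zero_le_one)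
  haveI : Finite W.sha := hfin
  have hmw0 : W.mordellWeilRank = 0 := by rw [hmw, hr]
  obtain ⟨q₀, hq₀, hle⟩ := hKim W p hp hsurj hL hfin D hc
  -- positivity of the BSD denominators
  have hΩpos : 0 < W.realPeriodRat := W.realPeriodRat_pos_holds
  have hΩ : (W.realPeriodRat : ℂ) ≠ 0 := by exact_mod_cast hΩpos.ne'
  have hc0 : 0 < W.tamagawaProduct := W.tamagawaProduct_pos_holds
  have ht0 : 0 < W.torsionOrder := W.torsionOrder_pos_holds
  have hq₀0 : q₀ ≠ 0 := by
    rintro rfl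
    rw [Rat.cast_zero, div_eq_zero_iff] at hq₀
    exact hq₀.elim hL hΩ
  refine ⟨q₀ * (W.torsionOrder : ℚ) ^ 2 / (W.tamagawaProduct : ℚ), ?_, ?_⟩
  · -- `#Ш_an = (L(E,1)/Ω) · #tors² / ∏ c_ℓ`
    have hcp : (W.tamagawaProduct : ℂ) ≠ 0 := by exact_mod_cast hc0.ne'
    have hLq : W.entireLFunction 1 = (q₀ : ℂ) * (W.realPeriodRat : ℂ) := by
      rw [← hq₀, div_mul_cancel₀ _ hΩ]
    rw [shaAn_def, leadingLCoeff_eq_of_analyticRank_eq_zero W hr,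
      W.regulator_eq_one_of_rank_zero hmw0, hLq]
    push_cast
    field_simp
  · -- valuations: `ord_p(q₀ · #tors² / ∏c) + ord_p ∏c − 2 ord_p #tors = ord_p q₀ ≥ ord_p #Ш(p) = ord_p #Ш`
    have ht : (W.torsionOrder : ℚ) ≠ 0 := by exact_mod_cast ht0.ne'
    have hcq : (W.tamagawaProduct : ℚ) ≠ 0 := by exact_mod_cast hc0.ne'
    have hsha : padicValNat p (Nat.card (AddCommGroup.primaryComponent W.sha p)) =
        padicValNat p W.shaOrder := by
      unfold WeierstrassCurve.shaOrder
      exact padicValNat_card_addPrimaryComponent p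
    have hv : padicValRat p (q₀ * (W.torsionOrder : ℚ) ^ 2 / (W.tamagawaProduct : ℚ)) =
        padicValRat p q₀ + 2 * (padicValNat p W.torsionOrder : ℤ) -
          (padicValNat p W.tamagawaProduct : ℤ) := by
      rw [padicValRat.div (mul_ne_zero hq₀0 (pow_ne_zero 2 ht)) hcq,
        padicValRat.mul hq₀0 (pow_ne_zero 2 ht), pow_two, padicValRat.mul ht ht,
        padicValRat.of_nat, padicValRat.of_nat]
      ring
    rw [hv, ← hsha]
    linarith

/-! ### From an upper bound to `BSD(E,p)` at a `p`-unit analytic `Ш` -/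

omit [W.IsGloballyMinimal] in
/-- **Bookkeeping: an upper bound `ord_p #Ш ≤ ord_p #Ш_an + ord_p ∏ c_ℓ` with `p ∤ ∏ c_ℓ` and
`#Ш_an` a `p`-unit gives Miller's `BSD(E,p)` in analytic rank `≤ 1`** (Gross–Zagier–Kolyvagin `hGZK`
for rank and finiteness): both valuations are `0` (`Typed.bsdp_of_missingPPartAt`). Used twice below
(Kim's theorem at `p ≥ 5`; the conjecture X4♯(3) at `p = 3`). [cite: Miller2011LMS, §1 and Def. 1.1] -/
theorem bsdp_of_shaOrder_le_of_shaAn_unit (hGZK : rank_eq_analyticRank_of_analyticRank_le_one)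
    (hr : W.analyticRank ≤ 1)
    (hub : ∃ q : ℚ, shaAn W = (q : ℂ) ∧
      (padicValNat p W.shaOrder : ℤ) ≤ padicValRat p q + padicValNat p W.tamagawaProduct)
    (htam : ¬ p ∣ W.tamagawaProduct) {q : ℚ} (hq : shaAn W = (q : ℂ)) (hv : padicValRat p q = 0) :
    BSDp W p := by
  obtain ⟨q', hq', hle⟩ := hub
  have hqq : q' = q := by exact_mod_cast hq'.symm.trans hq
  subst hqq
  rw [hv, padicValNat.eq_zero_of_not_dvd htam, Nat.cast_zero, add_zero] at hle
  have h0 : padicValNat p W.shaOrder = 0 := by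
    exact_mod_cast le_antisymm (by exact_mod_cast hle) (Nat.cast_nonneg _)
  exact bsdp_of_missingPPartAt W p hGZK hr ⟨q', hq', by rw [hv, h0, Nat.cast_zero]⟩

/-! ### Class X4, analytic rank `0`, `p ≥ 5`, surjective image -/

/-- **X4 ∧ `r = 0`, `p ≥ 5`, `ρ̄_{E,p}` surjective, Manin constant of `D` prime to `p`:
`ord_p #Ш(E) ≤ ord_p #Ш_an(E) + ord_p ∏ c_ℓ`** — the "≤" half of the sharpened conjecture
X4♯(unit-free), from PUBLISHED theorems (Kim 2026 Thm. 1.8 (6) `hKim`, Gross–Zagier–Kolyvagin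
`hGZK`, modularity `hmod`); the torsion term of the class-agnostic bound vanishes because `E[p]` is
irreducible (`hX.2.2`, Mazur 1977). Census shape over the cell's predicates.
[cite: Kim2022StructureSelmer, Thm. 1.9 (6) (PDF p. 8)] [cite: Mazur1977, Ch. III §5, p. 157] -/
theorem X4RankZero.padicValNat_shaOrder_le (hKim : Kim2026.rankZero_padicValNat_sha_le_of_maninConstant)
    (hGZK : rank_eq_analyticRank_of_analyticRank_le_one) (hmod : hasEntireLFunction_rat)
    (hp : 5 ≤ p) (hr : W.analyticRank = 0) (hX : ClassX4 W p) (hsurj : Surj W p)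
    {N : ℕ} [NeZero N] (D : ModularParametrizationData W N) (hc : ¬ (p : ℤ) ∣ D.maninConstant) :
    ∃ q : ℚ, shaAn W = (q : ℂ) ∧
      (padicValNat p W.shaOrder : ℤ) ≤ padicValRat p q + padicValNat p W.tamagawaProduct := by
  obtain ⟨q, hq, hle⟩ :=
    padicValNat_shaOrder_le_of_kim_rankZero W p hKim hGZK hmod hp hr hsurj D hc
  refine ⟨q, hq, ?_⟩
  rw [padicValNat_torsionOrder_eq_zero_of_irreducible W p hX.2.2] at hle
  simpa using hle

/-- **The typed UPPER half holds on X4 ∧ `r = 0` at `p ≥ 5` with `ρ̄` onto, `p ∤ c_D` and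
`p ∤ ∏ c_ℓ`**: `MissingUpperBoundAt W p` (`ord_p #Ш ≤ ord_p #Ш_an`). One inequality of the `p`-part,
from published theorems. [cite: Kim2022StructureSelmer, Thm. 1.9 (6) (PDF p. 8)] [cite: Miller2011LMS, Def. 1.1] -/
theorem X4RankZero.missingUpperBoundAt (hKim : Kim2026.rankZero_padicValNat_sha_le_of_maninConstant)
    (hGZK : rank_eq_analyticRank_of_analyticRank_le_one) (hmod : hasEntireLFunction_rat)
    (hp : 5 ≤ p) (hr : W.analyticRank = 0) (hX : ClassX4 W p) (hsurj : Surj W p)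
    {N : ℕ} [NeZero N] (D : ModularParametrizationData W N) (hc : ¬ (p : ℤ) ∣ D.maninConstant)
    (htam : ¬ p ∣ W.tamagawaProduct) : MissingUpperBoundAt W p := by
  obtain ⟨q, hq, hle⟩ := X4RankZero.padicValNat_shaOrder_le W p hKim hGZK hmod hp hr hX hsurj D hc
  refine ⟨q, hq, ?_⟩
  rw [padicValNat.eq_zero_of_not_dvd htam, Nat.cast_zero, add_zero] at hle
  exact hle

/-- **What remains of X4♯(unit-free) at these pairs is the LOWER half**: on X4 ∧ `r = 0`, `p ≥ 5`,
`ρ̄` onto, `p ∤ c_D`, `p ∤ ∏ c_ℓ`, the typed missing input `MissingPPartAt W p` is EQUIVALENT to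
`MissingLowerBoundAt W p` (`ord_p #Ш_an ≤ ord_p #Ш`, the main-conjecture / Eisenstein direction —
Kim's Conjecture 1.10 `∂^{(∞)}(δ̃) = 0` here). [cite: Kim2022StructureSelmer, Conj. 1.10 (PDF p. 8)]
[cite: Miller2011LMS, Def. 1.1] -/
theorem X4RankZero.missingPPartAt_iff_lower (hKim : Kim2026.rankZero_padicValNat_sha_le_of_maninConstant)
    (hGZK : rank_eq_analyticRank_of_analyticRank_le_one) (hmod : hasEntireLFunction_rat)
    (hp : 5 ≤ p) (hr : W.analyticRank = 0) (hX : ClassX4 W p) (hsurj : Surj W p)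
    {N : ℕ} [NeZero N] (D : ModularParametrizationData W N) (hc : ¬ (p : ℤ) ∣ D.maninConstant)
    (htam : ¬ p ∣ W.tamagawaProduct) : MissingPPartAt W p ↔ MissingLowerBoundAt W p :=
  ⟨fun h => (lower_and_upper_of_missingPPartAt W p h).1, fun h =>
    missingPPartAt_of_lower_of_upper W p h
      (X4RankZero.missingUpperBoundAt W p hKim hGZK hmod hp hr hX hsurj D hc htam)⟩

/-- **`BSD(E,p)` on X4 ∧ `r = 0` at `p ≥ 5` from the LOWER half alone** (`ρ̄` onto, `p ∤ c_D`,
`p ∤ ∏ c_ℓ`): the upper half being a theorem, any proof of `ord_p #Ш_an ≤ ord_p #Ш` at such a pair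
closes it (via `Typed.X4.bsdp_of_missingInputAt`). [cite: Miller2011LMS, §1 and Def. 1.1] -/
theorem X4RankZero.bsdp_of_missingLowerBoundAt (hKim : Kim2026.rankZero_padicValNat_sha_le_of_maninConstant)
    (hGZK : rank_eq_analyticRank_of_analyticRank_le_one) (hmod : hasEntireLFunction_rat)
    (hp : 5 ≤ p) (hr : W.analyticRank = 0) (hX : ClassX4 W p) (hsurj : Surj W p)
    {N : ℕ} [NeZero N] (D : ModularParametrizationData W N) (hc : ¬ (p : ℤ) ∣ D.maninConstant)
    (htam : ¬ p ∣ W.tamagawaProduct) (hlow : MissingLowerBoundAt W p) : BSDp W p :=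
  X4.bsdp_of_missingInputAt hGZK W p (by rw [hr]; exact zero_le_one) hX
    ((X4RankZero.missingPPartAt_iff_lower W p hKim hGZK hmod hp hr hX hsurj D hc htam).mpr hlow)

/-- **T-KIM0 without a certificate: `BSD(E,p)` on X4 ∧ `r = 0` at `p ≥ 5` with `ρ̄_{E,p}` onto,
`p ∤ c_D` and `p ∤ ∏ c_ℓ · #Ш_an`.** If the lane's exact `#Ш_an = q` is a `p`-unit, the inequality
`ord_p #Ш ≤ ord_p #Ш_an + ord_p ∏ c_ℓ = 0` forces `ord_p #Ш = 0 = ord_p #Ш_an`, i.e. Miller's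
`BSD(E,p)` (`Typed.bsdp_of_missingPPartAt`). PUBLISHED theorems (Kim 2026 Thm. 1.8 (6),
Gross–Zagier–Kolyvagin, modularity) + per pair ONLY [`r_an = 0`, `#Ш_an` a `p`-unit, `p ∤ ∏ c_ℓ`,
`p ∤ c_D`, surj(p)] — NO Kurihara number, no main conjecture. The census counts 2392 ‖ 660 X4 pairs
of this shape (`N < 2·10⁴ ‖ 10⁴`; SHARPENED §4 "NONE fails"). Per pair; the class label is unchanged.
[cite: Kim2022StructureSelmer, Thm. 1.9 (6) (PDF p. 8)] [cite: Miller2011LMS, §1 and Def. 1.1] -/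
theorem X4RankZero.bsdp_of_shaAn_unit (hKim : Kim2026.rankZero_padicValNat_sha_le_of_maninConstant)
    (hGZK : rank_eq_analyticRank_of_analyticRank_le_one) (hmod : hasEntireLFunction_rat)
    (hp : 5 ≤ p) (hr : W.analyticRank = 0) (hX : ClassX4 W p) (hsurj : Surj W p)
    {N : ℕ} [NeZero N] (D : ModularParametrizationData W N) (hc : ¬ (p : ℤ) ∣ D.maninConstant)
    (htam : ¬ p ∣ W.tamagawaProduct) {q : ℚ} (hq : shaAn W = (q : ℂ)) (hv : padicValRat p q = 0) :
    BSDp W p :=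
  bsdp_of_shaOrder_le_of_shaAn_unit W p hGZK (by rw [hr]; exact zero_le_one)
    (X4RankZero.padicValNat_shaOrder_le W p hKim hGZK hmod hp hr hX hsurj D hc) htam hq hv

/-- The same, concluding the typed missing input of class X4 (`Typed.X4.MissingInputAt W p`) rather
than `BSD(E,p)` — the currency of `Typed/X4.lean`. [cite: Miller2011LMS, Def. 1.1] -/
theorem X4RankZero.missingInputAt_of_shaAn_unit (hKim : Kim2026.rankZero_padicValNat_sha_le_of_maninConstant)
    (hGZK : rank_eq_analyticRank_of_analyticRank_le_one) (hmod : hasEntireLFunction_rat)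
    (hp : 5 ≤ p) (hr : W.analyticRank = 0) (hX : ClassX4 W p) (hsurj : Surj W p)
    {N : ℕ} [NeZero N] (D : ModularParametrizationData W N) (hc : ¬ (p : ℤ) ∣ D.maninConstant)
    (htam : ¬ p ∣ W.tamagawaProduct) {q : ℚ} (hq : shaAn W = (q : ℂ)) (hv : padicValRat p q = 0) :
    X4.MissingInputAt W p := by
  haveI : Finite W.sha := (hGZK W (by rw [hr]; exact zero_le_one)).2
  exact missingPPartAt_of_bsdp W p
    (X4RankZero.bsdp_of_shaAn_unit W p hKim hGZK hmod hp hr hX hsurj D hc htam hq hv)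

/-! ### What the conjecture X4♯(3) would buy at `p = 3` (conditional; nothing asserted) -/

/-- **X4♯(3) ⇒ `BSD(E,3)` on its unit rows.** If the data-suggested conjecture
`Additive.X4SharpThree` (Kim's inequality at `p = 3`; `Additive/SharpenedStatements.lean`) holds,
then every X4 pair at `p = 3` of analytic rank `0` with `ρ̄_{E,3}` surjective, a parametrisation
datum `D` with `3 ∤ c_D`, `3 ∤ ∏ c_ℓ` and `#Ш_an` a `3`-unit satisfies Miller's `BSD(E,3)` — the
1582 ‖ 417 pairs where Kim's hypothesis `p ≥ 5` binds ALONE (SHARPENED §4 (i)). CONDITIONAL on the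
conjecture (hypothesis `h3`), which is OPEN; Gross–Zagier–Kolyvagin `hGZK`. [cite: Miller2011LMS, §1 and Def. 1.1] -/
theorem bsdp_three_of_x4SharpThree (h3 : X4SharpThree)
    (hGZK : rank_eq_analyticRank_of_analyticRank_le_one) (hr : W.analyticRank = 0)
    (hX : ClassX4 W 3) (hsurj : Surj W 3)
    {N : ℕ} [NeZero N] (D : ModularParametrizationData W N) (hc : ¬ (3 : ℤ) ∣ D.maninConstant)
    (htam : ¬ 3 ∣ W.tamagawaProduct) {q : ℚ} (hq : shaAn W = (q : ℂ)) (hv : padicValRat 3 q = 0) :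
    BSDp W 3 :=
  bsdp_of_shaOrder_le_of_shaAn_unit W 3 hGZK (by rw [hr]; exact zero_le_one)
    (h3 W hr hX hsurj D hc) htam hq hv

end Summit.BirchSwinnertonDyer.Rank1Residual.Additive

end
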